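import Summits.Ventures.PackingBounds.Energy.NFGramPSD
import Summits.Ventures.PackingBounds.Energy.GramListQuadL
import HarnessLib

/-!
# List-structural quadratic forms for number-field Gram data (KERNEL-NF bridge layer)

Framing: lottery ticket; floor = certified bounds/negative ranges. Venture `PackingBounds`, cell `pub-packcert`,
energy family E3PT (pub-packcert-energy gen 22; companion of `NFGramPSD`, the number-field analogue of
`GramListQuad` / `GramListQuadL`).

`NFGram.psd_of_nf_checks2` delivers `0 ≤ Σ_{i,j : Fin r} (leval ξ F_{ij} / Dn_{ij}) · y_i · y_j` for an `F`-valued block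
given as integer data. To compare this with an explicit Gram form generated from a certificate (a polynomial identity
in the SOS variables and `ξ`, closed by `ring` / `linear_combination`), the double sum must be unfolded STRUCTURALLY,
with no index arithmetic: `listQuadF` (vector as a function `y : ℕ → ℝ`) and `quadLF` (vector as an explicit list
`ms`) do this by pattern matching on the data lists; `listQuadF_eq_sum_entF` identifies `listQuadF` with the
`entF/entN`-indexed double sum once and for all, `quadLF_eq_listQuadF` identifies the two structural forms, and
`quadLF_append` splits a table into row blocks (one gate-sized file per block).
-/

namespace Summit.Ventures.PackingBounds.Energy.NFGram

open Finset
open Summit.Ventures.PackingBounds.Config.AlgWeighted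
open Summit.Ventures.PackingBounds.Energy.GramData

/-- `Σ_k (leval ξ fs[k] / ds[k]) · y i · y (j0 + k)`, structurally in the entry lists (stops at the shorter list). -/
noncomputable def rowQuadF (ξ : ℝ) (y : ℕ → ℝ) (i : ℕ) : List (List ℤ) → List ℕ → ℕ → ℝ
  | [], _, _ => 0
  | _ :: _, [], _ => 0
  | f :: fs, d :: ds, j0 => (leval ξ f / (d : ℝ)) * y i * y j0 + rowQuadF ξ y i fs ds (j0 + 1)

/-- `Σ_m rowQuadF (F[m]) (Dn[m]) (i0 + m)`, structurally in the row lists (stops at the shorter list). -/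
noncomputable def listQuadF (ξ : ℝ) (y : ℕ → ℝ) : List (List (List ℤ)) → List (List ℕ) → ℕ → ℝ
  | [], _, _ => 0
  | _ :: _, [], _ => 0
  | row :: rows, drow :: drows, i0 => rowQuadF ξ y i0 row drow 0 + listQuadF ξ y rows drows (i0 + 1)

/-- `rowQuadF` as an indexed sum (entry lists of equal length). -/
theorem rowQuadF_eq (ξ : ℝ) (y : ℕ → ℝ) (i : ℕ) :
    ∀ (fs : List (List ℤ)) (ds : List ℕ) (j0 : ℕ), fs.length = ds.length →
      rowQuadF ξ y i fs ds j0 = ∑ k ∈ range fs.length, (leval ξ (fs.getD k []) / (ds.getD k 0 : ℝ)) * y i * y (j0 + k)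
  | [], ds, j0, _ => by simp [rowQuadF]
  | f :: fs, [], j0, h => absurd h (by simp)
  | f :: fs, d :: ds, j0, h => by
    rw [rowQuadF, List.length_cons, Finset.sum_range_succ', rowQuadF_eq ξ y i fs ds (j0 + 1) (by simpa using h)]
    simp only [List.getD_cons_zero, List.getD_cons_succ, Nat.add_zero]
    rw [add_comm]
    congr 1
    refine Finset.sum_congr rfl fun k _ => ?_
    rw [show j0 + 1 + k = j0 + (k + 1) by omega]

/-- `listQuadF` as an indexed double sum (row lists of equal length, entry lists of equal length per row). -/
theorem listQuadF_eq (ξ : ℝ) (y : ℕ → ℝ) :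
    ∀ (F : List (List (List ℤ))) (Dn : List (List ℕ)) (i0 : ℕ), F.length = Dn.length →
      (∀ m, m < F.length → (F.getD m []).length = (Dn.getD m []).length) →
      listQuadF ξ y F Dn i0 = ∑ m ∈ range F.length,
        ∑ k ∈ range (F.getD m []).length,
          (leval ξ ((F.getD m []).getD k []) / ((Dn.getD m []).getD k 0 : ℝ)) * y (i0 + m) * y k
  | [], Dn, i0, _, _ => by simp [listQuadF]
  | row :: rows, [], i0, h, _ => absurd h (by simp)
  | row :: rows, drow :: drows, i0, h, hrow => by
    have h0 : row.length = drow.length := by simpa using hrow 0 (by simp)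
    rw [listQuadF, List.length_cons, Finset.sum_range_succ', listQuadF_eq ξ y rows drows (i0 + 1) (by simpa using h)
      (fun m hm => by simpa using hrow (m + 1) (by simpa using hm)), rowQuadF_eq ξ y i0 row drow 0 h0]
    simp only [List.getD_cons_zero, List.getD_cons_succ, Nat.add_zero, Nat.zero_add]
    rw [add_comm]
    congr 1
    refine Finset.sum_congr rfl fun m _ => ?_
    rw [show i0 + 1 + m = i0 + (m + 1) by omega]

/-- **The bridge.** For `r × r` tables `F`, `Dn` (all rows of length `r`), `listQuadF ξ y F Dn 0` is the
`entF/entN`-indexed double sum of `NFGram.psd_of_nf_checks2`. -/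
theorem listQuadF_eq_sum_entF (ξ : ℝ) (y : ℕ → ℝ) (F : List (List (List ℤ))) (Dn : List (List ℕ)) (r : ℕ)
    (hF : F.length = r) (hD : Dn.length = r) (hFrow : ∀ m, m < r → (F.getD m []).length = r)
    (hDrow : ∀ m, m < r → (Dn.getD m []).length = r) :
    listQuadF ξ y F Dn 0 = ∑ i : Fin r, ∑ j : Fin r, (leval ξ (entF F i j) / (entN Dn i j : ℝ)) * y i * y j := by
  rw [listQuadF_eq ξ y F Dn 0 (by rw [hF, hD]) (fun m hm => by rw [hFrow m (hF ▸ hm), hDrow m (hF ▸ hm)]), hF,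
    Fin.sum_univ_eq_sum_range (fun i => ∑ j : Fin r, (leval ξ (entF F i j) / (entN Dn i j : ℝ)) * y i * y j) r]
  refine Finset.sum_congr rfl fun m hm => ?_
  rw [hFrow m (Finset.mem_range.1 hm),
    Fin.sum_univ_eq_sum_range (fun j => (leval ξ (entF F m j) / (entN Dn m j : ℝ)) * y m * y j) r]
  refine Finset.sum_congr rfl fun k _ => ?_
  simp [entF, entN]

/-! ### The same with the vector as an explicit LIST (no per-entry function rewrites) -/

/-- `Σ_k (leval ξ fs[k] / ds[k]) · c · ms[k]`, structurally in the three lists. -/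
noncomputable def rowDotF (ξ : ℝ) (c : ℝ) : List (List ℤ) → List ℕ → List ℝ → ℝ
  | f :: fs, d :: ds, m :: ms => (leval ξ f / (d : ℝ)) * c * m + rowDotF ξ c fs ds ms
  | _, _, _ => 0

/-- `Σ_a rest[a] · rowDotF (F[a]) (Dn[a]) ms`, structurally. -/
noncomputable def quadLF (ξ : ℝ) (ms : List ℝ) : List (List (List ℤ)) → List (List ℕ) → List ℝ → ℝ
  | row :: rows, drow :: drows, m :: rest => rowDotF ξ m row drow ms + quadLF ξ ms rows drows rest
  | _, _, _ => 0

/-- `quadLF` over an exhausted entry list vanishes. -/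
@[simp] theorem quadLF_nil_right (ξ : ℝ) (ms : List ℝ) :
    ∀ (B : List (List (List ℤ))) (D : List (List ℕ)), quadLF ξ ms B D [] = 0
  | [], _ => by simp [quadLF]
  | _ :: _, [] => by simp [quadLF]
  | _ :: _, _ :: _ => by simp [quadLF]

/-- `rowDotF ξ (y i) fs ds ms = rowQuadF ξ y i fs ds j0` when `ms` lists the values `y (j0 + k)`. -/
theorem rowDotF_eq (ξ : ℝ) (y : ℕ → ℝ) (i : ℕ) :
    ∀ (fs : List (List ℤ)) (ds : List ℕ) (j0 : ℕ) (ms : List ℝ), fs.length = ds.length → fs.length ≤ ms.length →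
      (∀ k, k < fs.length → ms.getD k 0 = y (j0 + k)) → rowDotF ξ (y i) fs ds ms = rowQuadF ξ y i fs ds j0
  | [], ds, j0, ms, _, _, _ => by cases ds <;> cases ms <;> simp [rowDotF, rowQuadF]
  | f :: fs, [], j0, ms, h, _, _ => absurd h (by simp)
  | f :: fs, d :: ds, j0, [], _, h, _ => absurd h (by simp)
  | f :: fs, d :: ds, j0, m :: ms, h, hl, hk => by
    rw [rowDotF, rowQuadF]
    have hm : m = y j0 := by
      have h0 := hk 0 (by simp)
      simpa using h0
    have ih := rowDotF_eq ξ y i fs ds (j0 + 1) ms (by simpa using h) (by simpa using hl) (fun k hk' => by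
      have h1 := hk (k + 1) (by simpa using hk')
      rw [List.getD_cons_succ] at h1
      rw [h1, show j0 + (k + 1) = j0 + 1 + k by omega])
    rw [hm, ih]

/-- **`quadLF` is `listQuadF`:** if `ms` lists the values of `y`, rows of `F`/`Dn` have matching lengths `≤ ms.length`
and `F.length + i0 ≤ ms.length`, then `quadLF ξ ms F Dn (ms.drop i0) = listQuadF ξ y F Dn i0`. -/
theorem quadLF_eq_listQuadF (ξ : ℝ) (y : ℕ → ℝ) (ms : List ℝ) (hms : ∀ k, k < ms.length → ms.getD k 0 = y k) :
    ∀ (F : List (List (List ℤ))) (Dn : List (List ℕ)) (i0 : ℕ), F.length = Dn.length →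
      (∀ m, m < F.length → (F.getD m []).length = (Dn.getD m []).length) →
      (∀ row ∈ F, row.length ≤ ms.length) → F.length + i0 ≤ ms.length →
      quadLF ξ ms F Dn (ms.drop i0) = listQuadF ξ y F Dn i0
  | [], Dn, i0, _, _, _, _ => by cases Dn <;> simp [quadLF, listQuadF]
  | row :: rows, [], i0, h, _, _, _ => absurd h (by simp)
  | row :: rows, drow :: drows, i0, h, hrl, hrow, hlen => by
    have hi0 : i0 < ms.length := by
      simp only [List.length_cons] at hlen; omega
    have h0 : row.length = drow.length := by simpa using hrl 0 (by simp)
    rw [GramData.drop_eq_getD_cons ms i0 hi0, quadLF, listQuadF, hms i0 hi0,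
      rowDotF_eq ξ y i0 row drow 0 ms h0 (hrow row (by simp)) (fun k hk => by
        rw [Nat.zero_add]; exact hms k (lt_of_lt_of_le hk (hrow row (by simp)))),
      quadLF_eq_listQuadF ξ y ms hms rows drows (i0 + 1) (by simpa using h)
        (fun m hm => by simpa using hrl (m + 1) (by simpa using hm)) (fun r hr => hrow r (by simp [hr])) (by
        simp only [List.length_cons] at hlen; omega)]

/-- The same at offset `0`. -/
theorem quadLF_eq_listQuadF_zero (ξ : ℝ) (y : ℕ → ℝ) (ms : List ℝ) (hms : ∀ k, k < ms.length → ms.getD k 0 = y k)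
    (F : List (List (List ℤ))) (Dn : List (List ℕ)) (h : F.length = Dn.length)
    (hrl : ∀ m, m < F.length → (F.getD m []).length = (Dn.getD m []).length)
    (hrow : ∀ row ∈ F, row.length ≤ ms.length) (hlen : F.length ≤ ms.length) :
    quadLF ξ ms F Dn ms = listQuadF ξ y F Dn 0 := by
  have h' := quadLF_eq_listQuadF ξ y ms hms F Dn 0 h hrl hrow (by simpa using hlen)
  simpa using h'

/-- **Row-block splitting:** `quadLF ξ ms (A ++ B) (DA ++ DB) rest = quadLF ξ ms A DA rest + quadLF ξ ms B DB (rest.drop A.length)`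
when `A` and `DA` have the same length. -/
theorem quadLF_append (ξ : ℝ) (ms : List ℝ) :
    ∀ (A B : List (List (List ℤ))) (DA DB : List (List ℕ)) (rest : List ℝ), A.length = DA.length →
      quadLF ξ ms (A ++ B) (DA ++ DB) rest = quadLF ξ ms A DA rest + quadLF ξ ms B DB (rest.drop A.length)
  | [], B, [], DB, rest, _ => by simp [quadLF]
  | [], B, _ :: _, DB, rest, h => absurd h (by simp)
  | _ :: _, B, [], DB, rest, h => absurd h (by simp)
  | row :: A, B, drow :: DA, DB, [], _ => by simp [quadLF]
  | row :: A, B, drow :: DA, DB, m :: rest, h => by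
    rw [List.cons_append, List.cons_append, quadLF, quadLF, quadLF_append ξ ms A B DA DB rest (by simpa using h),
      List.length_cons, List.drop_succ_cons, add_assoc]

end Summit.Ventures.PackingBounds.Energy.NFGram
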